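import Summits.NavierStokesRegularity.NavierStokesRegularity.Theorems.EfficiencyFloorRigidExitReferenceShadowingTransport
import Summits.NavierStokesRegularity.NavierStokesRegularity.Theorems.EfficiencyFloorRigidExitReferenceShadowingNormalised
import Summits.NavierStokesRegularity.NavierStokesRegularity.Theorems.EfficiencyFloorRigidExitReferenceShadowing
import Summits.NavierStokesRegularity.NavierStokesRegularity.Theorems.EfficiencyFloorRigidExitReferenceExit
import HarnessLib

/-!
# Route `EfficiencyFloor`: the support item `RigidExit` (stmt-NavierStokesRegularity-25513) PROVED —
# `MaximiserSetRigidity → NearMaximiserBoundedAmplification`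

Closing file for the support item `RigidExit` of the route (line ns-idea-5 g3 «rigid_extremiser» on the
`ProductionEfficiencyDecay` ladder, stmt-NavierStokesRegularity-22866). The door is the landed BY-NAME reduction
`ReferenceShadowing.rigidExit_of_referenceShadowing_of_maximiserSetRigidity` (p839834/p839853): under `MaximiserSetRigidity`, for
the sharp constant `c⋆` and every normalised maximiser `m` at `ν = 1` one must produce numbers `η, θ, κ, ε` and ONE function `v`
with the reference deficit (R-exit) and the orbit-uniform shadowing (R-shadow). Here:

* `v` = Leray's reference flow through `m` on the window fraction `[0, η₀ W_m]` (`ReferenceFlow.exists_referenceFlow_window`,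
  p839713), `η = η₀/8`;
* (R-exit) = `ReferenceExit.referenceDeficit_of_maximiserSetRigidity` (p839920) — the only place where clause (a) and the PROVED
  clause (b) of `MaximiserSetRigidity` enter;
* `κ` from the compatibility inequality (`exists_compat`, elementary);
* (R-shadow) = `shadowing_of_normalised`: a route-class flow `u` whose slice `u(s)` is `ε`-close to an orbit point
  `g·m = l₀•R₀ m(l₀•R₀⁻¹(·−a₀))` is transported by `g⁻¹` to a Tao-class slab solution near `m` at time `0`
  (`ReferenceShadowing.transport`, this hand), compared with `v` by the normalised shadowing estimate
  (`ReferenceShadowing.normalised_shadowing`, this hand), and transported back with the enstrophy covariance `Z ↦ l·Z`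
  (`RigidExit.integral_curl_sq_orbitSlice`); the scale clause is `orbit_scale_window` (p839944).

Main results: `shadowing_of_normalised` ((R-shadow) from the normalised shadowing), `exists_compat`, and
**`efficiencyFloor_rigidExit_proof : Theses.EfficiencyFloor.RigidExit`**.

HONEST FRAMING: `RigidExit` is the implication `MaximiserSetRigidity → NearMaximiserBoundedAmplification` between two statements
about the (hypothetical) Lu–Doering maximisers; clause (a) of `MaximiserSetRigidity` (finitely many maximiser orbits),
`NearSaturationNearMaximiser`, `LerayFloorGap`, `ProductionEfficiencyDecay` (stmt-22866) and Navier–Stokes regularity stay OPEN;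
no summit statement is proved. [folklore]
-/

-- the problem directory repeats the summit name (`NavierStokesRegularity/NavierStokesRegularity`)
set_option linter.dupNamespace false

noncomputable section

open Set Filter MeasureTheory Topology Function
open scoped InnerProductSpace RealInnerProductSpace ENNReal NNReal ContDiff
open Literature.Analysis.FluidPDE

namespace Summit.NavierStokesRegularity.NavierStokesRegularity.Theorems

namespace RigidExit

namespace ReferenceShadowing

open NearMaximiserBoundedAmplification Resonance

/-! ## §1 The compatibility inequality -/

/-- For `0 < η < 1` and `θ > 0` there is `κ ∈ (0,1]` with `((1+κ)/√(1−η+4θ) + κ)²·(1−η+2θ) ≤ 1`. [folklore] -/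
theorem exists_compat {η θ : ℝ} (hη0 : 0 < η) (hη1 : η < 1) (hθ : 0 < θ) :
    ∃ κ : ℝ, 0 < κ ∧ κ ≤ 1 ∧ ((1 + κ) / Real.sqrt (1 - η + 4 * θ) + κ) ^ 2 * (1 - η + 2 * θ) ≤ 1 := by
  have hq4 : 0 < 1 - η + 4 * θ := by linarith
  have hq2 : 0 < 1 - η + 2 * θ := by linarith
  have hlt : 1 - η + 2 * θ < 1 - η + 4 * θ := by linarith
  set rr : ℝ := Real.sqrt (1 - η + 4 * θ) with hrr
  have hrr0 : 0 < rr := Real.sqrt_pos.2 hq4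
  have hrr2 : rr ^ 2 = 1 - η + 4 * θ := Real.sq_sqrt hq4.le
  -- `x = min 1 ((q₄/q₂ − 1)/3)`, `κ = x/(1 + rr)`
  have hratio : 1 < (1 - η + 4 * θ) / (1 - η + 2 * θ) := by rw [one_lt_div hq2]; exact hlt
  obtain ⟨x, hx_def⟩ : ∃ x : ℝ, x = min 1 (((1 - η + 4 * θ) / (1 - η + 2 * θ) - 1) / 3) := ⟨_, rfl⟩
  have hx0 : 0 < x := by rw [hx_def]; exact lt_min one_pos (by linarith)
  have hx1 : x ≤ 1 := by rw [hx_def]; exact min_le_left _ _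
  have hx3 : 3 * x ≤ (1 - η + 4 * θ) / (1 - η + 2 * θ) - 1 := by
    have := min_le_right 1 (((1 - η + 4 * θ) / (1 - η + 2 * θ) - 1) / 3)
    rw [← hx_def] at this
    linarith
  refine ⟨x / (1 + rr), by positivity, ?_, ?_⟩
  · rw [div_le_one (by positivity)]
    linarith
  · have hsum : (1 + x / (1 + rr)) / rr + x / (1 + rr) = (1 + x) / rr := by
      field_simp
      ring
    rw [hsum, div_pow, hrr2]
    -- `(1+x)² (1−η+2θ) ≤ 1−η+4θ`
    have h13 : (1 + x) ^ 2 ≤ 1 + 3 * x := by nlinarith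
    have hkey : (1 + 3 * x) * (1 - η + 2 * θ) ≤ 1 - η + 4 * θ := by
      have h := mul_le_mul_of_nonneg_right hx3 hq2.le
      rw [sub_mul, div_mul_cancel₀ _ hq2.ne', one_mul] at h
      linarith
    rw [div_mul_eq_mul_div, div_le_one hq4]
    calc (1 + x) ^ 2 * (1 - η + 2 * θ) ≤ (1 + 3 * x) * (1 - η + 2 * θ) :=
          mul_le_mul_of_nonneg_right h13 hq2.le
      _ ≤ 1 - η + 4 * θ := hkey

/-! ## §2 The inverse orbit element -/

/-- The orbit element `(−(l₀•R₀⁻¹a₀), R₀⁻¹, l₀⁻¹)` inverts `(a₀, R₀, l₀)` on slices. [folklore] -/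
theorem orbitSlice_inv (f : EuclideanSpace ℝ (Fin 3) → EuclideanSpace ℝ (Fin 3)) (a₀ : EuclideanSpace ℝ (Fin 3))
    (R₀ : EuclideanSpace ℝ (Fin 3) ≃ₗᵢ[ℝ] EuclideanSpace ℝ (Fin 3)) {l₀ : ℝ} (hl₀ : 0 < l₀) :
    (fun x => l₀⁻¹ • R₀.symm ((fun y => l₀ • R₀ (f (l₀ • R₀.symm (y - a₀))))
      (l₀⁻¹ • R₀.symm.symm (x - -(l₀ • R₀.symm a₀))))) = f := by
  funext x
  have hl : l₀ ≠ 0 := hl₀.ne'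
  simp only [LinearIsometryEquiv.symm_symm, sub_neg_eq_add, map_add,
    LinearIsometryEquiv.apply_symm_apply, smul_add, smul_smul, inv_mul_cancel₀ hl, one_smul, add_sub_cancel_right,
    map_smul, LinearIsometryEquiv.symm_apply_apply, mul_inv_cancel₀ hl]

/-! ## §3 (R-shadow) from the normalised shadowing -/

/-- **(R-shadow) from the normalised shadowing.** Fix `c > 0`, an admissible `m`, a function
`v`, `η > 0`, and numbers `0 < ε ≤ ε₀`, `ε ≤ 1`, `κ` with `(1+ε)² ≤ 1+κ`. Suppose the NORMALISED SHADOWING holds at `ν = 1` with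
`(κ, ε₀)`: every classical slab solution `(w,q_w)` on `[0,τ₂]` in the Sobolev class with `Z(w0) > 0`, `Z(w0 − m) ≤ ε₀² Z(w0)`,
`ηW_{w0} ≤ τ₂` has `Z(w(ηW_{w0})) ≤ Z(v(ηW_m)) + κ Z(w0)`. Then (R-shadow) holds: along every maximal classical Leray–Hopf
rapidly-decaying-datum solution `u` at `ν = 1`, if `u(s)` is `ε`-close (scale-free `Ḣ¹∩Ḣ²`) to an orbit point of `m` with
parameters `(a₀,R₀,l₀)` and the window fits, then `l₀·Z(m) ≤ (1+κ)·Z(u s)` and `Z(u(s+ηW(s))) ≤ l₀·Z(v(ηW_m)) + κ·Z(u s)`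
(transport by the inverse orbit element, `ReferenceShadowing.transport`, enstrophy covariance `Z ↦ l·Z`). [folklore] -/
theorem shadowing_of_normalised {c : ℝ} (hc0 : 0 < c)
    {m : EuclideanSpace ℝ (Fin 3) → EuclideanSpace ℝ (Fin 3)}
    (hm : ContDiff ℝ (⊤ : ℕ∞) m ∧ VectorCalculus.IsDivFree m ∧ (∫⁻ x, ‖iteratedFDeriv ℝ 0 m x‖ₑ ^ 2 < ⊤) ∧
      (∫⁻ x, ‖iteratedFDeriv ℝ 1 m x‖ₑ ^ 2 < ⊤) ∧ (∫⁻ x, ‖iteratedFDeriv ℝ 2 m x‖ₑ ^ 2 < ⊤))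
    {v : ℝ → EuclideanSpace ℝ (Fin 3) → EuclideanSpace ℝ (Fin 3)}
    {η κ ε ε₀ : ℝ} (hη : 0 < η) (hε : 0 < ε) (hεε₀ : ε ≤ ε₀) (hε1 : ε ≤ 1) (hκε : (1 + ε) ^ 2 ≤ 1 + κ)
    (hN : ∀ (w : ℝ → EuclideanSpace ℝ (Fin 3) → EuclideanSpace ℝ (Fin 3)) (qw : ℝ → EuclideanSpace ℝ (Fin 3) → ℝ) (τ₂ : ℝ),
      IsClassicalNSSolutionOn (Icc 0 τ₂) 1 0 w qw → HasBoundedSobolevNormsOn (Icc 0 τ₂) w →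
      HasBoundedSobolevNormsOn (Icc 0 τ₂) (timeDerivWithin (Icc 0 τ₂) w) →
      (∀ n : ℕ, ∃ C : ℝ≥0, ∀ t ∈ Icc 0 τ₂, ∫⁻ x, ‖iteratedFDeriv ℝ n (qw t) x‖ₑ ^ 2 ≤ C) →
      0 < (∫ x, ‖curl (w 0) x‖ ^ 2) →
      (∫ x, ‖curl (w 0 - m) x‖ ^ 2) ≤ ε₀ ^ 2 * (∫ x, ‖curl (w 0) x‖ ^ 2) →
      η * (64 * (1 : ℝ) ^ 3 / (27 * c ^ 4) * (∫ x, ‖curl (w 0) x‖ ^ 2)⁻¹ ^ 2) ≤ τ₂ →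
      (∫ x, ‖curl (w (η * (64 * (1 : ℝ) ^ 3 / (27 * c ^ 4) * (∫ x, ‖curl (w 0) x‖ ^ 2)⁻¹ ^ 2))) x‖ ^ 2) ≤
        (∫ x, ‖curl (v (η * (64 * (1 : ℝ) ^ 3 / (27 * c ^ 4) * (∫ x, ‖curl m x‖ ^ 2)⁻¹ ^ 2))) x‖ ^ 2) +
          κ * (∫ x, ‖curl (w 0) x‖ ^ 2)) :
    ∀ T : ℝ, 0 < T → ∀ (u : ℝ → EuclideanSpace ℝ (Fin 3) → EuclideanSpace ℝ (Fin 3)) (p : ℝ → EuclideanSpace ℝ (Fin 3) → ℝ),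
      IsMaximalSmoothSolution 1 0 u p T → IsLerayHopfOn T 1 0 (u 0) u → HasRapidSpatialDecay (u 0) →
      ∀ s ∈ Set.Ioo 0 T, (∃ (a : EuclideanSpace ℝ (Fin 3)) (R : EuclideanSpace ℝ (Fin 3) ≃ₗᵢ[ℝ] EuclideanSpace ℝ (Fin 3)) (l : ℝ),
        0 < l ∧ ((∫ x, ‖curl (u s - fun y => l • R (m (l • R.symm (y - a)))) x‖ ^ 2) ≤ ε ^ 2 * (∫ x, ‖curl (u s) x‖ ^ 2) ∧
        (∫ x, frobeniusNormSq (fderiv ℝ (curl (u s - fun y => l • R (m (l • R.symm (y - a))))) x)) ≤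
          ε ^ 2 * (∫ x, frobeniusNormSq (fderiv ℝ (curl (u s)) x)))) →
      s + η * (64 * (1 : ℝ) ^ 3 / (27 * c ^ 4) * (∫ x, ‖curl (u s) x‖ ^ 2)⁻¹ ^ 2) < T →
      ∃ l : ℝ, 0 < l ∧ l * (∫ x, ‖curl m x‖ ^ 2) ≤ (1 + κ) * (∫ x, ‖curl (u s) x‖ ^ 2) ∧
        (∫ x, ‖curl (u (s + η * (64 * (1 : ℝ) ^ 3 / (27 * c ^ 4) * (∫ x, ‖curl (u s) x‖ ^ 2)⁻¹ ^ 2))) x‖ ^ 2) ≤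
          l * (∫ x, ‖curl (v (η * (64 * (1 : ℝ) ^ 3 / (27 * c ^ 4) * (∫ x, ‖curl m x‖ ^ 2)⁻¹ ^ 2))) x‖ ^ 2) +
            κ * (∫ x, ‖curl (u s) x‖ ^ 2) := by
  intro T hT u p hmax hLH hdec s hs hclose hwinT
  obtain ⟨a₀, R₀, l₀, hl₀, hZclose, -⟩ := hclose
  -- the slice `u s`: admissible, positive enstrophy
  obtain ⟨c₁, -, hbud⟩ := efficiencyFloor_sharpLuDoeringBudget_proof
  obtain ⟨Zr, D, hZD⟩ := hbud 1 T one_pos hT u p hmax hLH hdec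
  have hadm : ContDiff ℝ (⊤ : ℕ∞) (u s) ∧ VectorCalculus.IsDivFree (u s) ∧ (∫⁻ x, ‖iteratedFDeriv ℝ 0 (u s) x‖ₑ ^ 2 < ⊤) ∧
      (∫⁻ x, ‖iteratedFDeriv ℝ 1 (u s) x‖ₑ ^ 2 < ⊤) ∧ (∫⁻ x, ‖iteratedFDeriv ℝ 2 (u s) x‖ₑ ^ 2 < ⊤) := (hZD s hs).2.2.1
  have hZs : 0 < ∫ x, ‖curl (u s) x‖ ^ 2 := by
    have h1 := lintegral_curl_sq_pos one_pos hT hmax hLH hdec s ⟨hs.1.le, hs.2⟩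
    rw [(hZD s hs).1] at h1
    rw [← (hZD s hs).2.2.2.1]
    exact ENNReal.ofReal_pos.1 h1
  -- the scale clause
  obtain ⟨hsc1, hsc2⟩ := orbit_scale_window hm hadm.1 hadm.2.2.2.1 a₀ R₀ hl₀ hε.le hε1 hZclose
  refine ⟨l₀, hl₀, hsc2.trans (mul_le_mul_of_nonneg_right hκε hZs.le), ?_⟩
  -- the transported flow by the inverse orbit element `(a, R, l) = (−(l₀•R₀⁻¹a₀), R₀⁻¹, l₀⁻¹)`
  have hl : 0 < l₀⁻¹ := inv_pos.2 hl₀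
  have hA : 0 < 64 * (1 : ℝ) ^ 3 / (27 * c ^ 4) := by positivity
  obtain ⟨L, hL_def⟩ : ∃ L : ℝ, L = η * (64 * (1 : ℝ) ^ 3 / (27 * c ^ 4) * (∫ x, ‖curl (u s) x‖ ^ 2)⁻¹ ^ 2) := ⟨_, rfl⟩
  have hL : 0 < L := by rw [hL_def]; positivity
  rw [← hL_def] at hwinT ⊢
  obtain ⟨qt, hwcl, hwS, hwSt, hwq⟩ :=
    transport hmax.1 hLH hdec hs.1 hL hwinT (-(l₀ • R₀.symm a₀)) R₀.symm hl
  -- facts about the transported slices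
  have hZ0 : (∫ x, ‖curl (fun x => l₀⁻¹ • R₀.symm (u s (l₀⁻¹ • R₀.symm.symm (x - -(l₀ • R₀.symm a₀))))) x‖ ^ 2) =
      l₀⁻¹ * ∫ x, ‖curl (u s) x‖ ^ 2 :=
    integral_curl_sq_orbitSlice (u s) (-(l₀ • R₀.symm a₀)) R₀.symm hl
  have hZ0pos : 0 < l₀⁻¹ * ∫ x, ‖curl (u s) x‖ ^ 2 := by positivity
  -- closeness at time `0`: `Z(ũ0 − m) = l₀⁻¹ Z(u s − g·m) ≤ ε₀² Z(ũ0)`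
  have hinv := orbitSlice_inv m a₀ R₀ hl₀
  have hdiff : (fun x => l₀⁻¹ • R₀.symm (u s (l₀⁻¹ • R₀.symm.symm (x - -(l₀ • R₀.symm a₀))))) - m =
      fun x => l₀⁻¹ • R₀.symm ((u s - fun y => l₀ • R₀ (m (l₀ • R₀.symm (y - a₀))))
        (l₀⁻¹ • R₀.symm.symm (x - -(l₀ • R₀.symm a₀)))) := by
    funext x
    have hx := congrFun hinv x
    simp only at hx
    rw [Pi.sub_apply, ← hx]
    simp only [Pi.sub_apply, map_sub, smul_sub]
  have hZdiff : (∫ x, ‖curl ((fun x => l₀⁻¹ • R₀.symm (u s (l₀⁻¹ • R₀.symm.symm (x - -(l₀ • R₀.symm a₀))))) - m) x‖ ^ 2) ≤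
      ε₀ ^ 2 * (l₀⁻¹ * ∫ x, ‖curl (u s) x‖ ^ 2) := by
    rw [hdiff, integral_curl_sq_orbitSlice _ (-(l₀ • R₀.symm a₀)) R₀.symm hl]
    have h1 : l₀⁻¹ * (∫ x, ‖curl (u s - fun y => l₀ • R₀ (m (l₀ • R₀.symm (y - a₀)))) x‖ ^ 2) ≤
        l₀⁻¹ * (ε ^ 2 * ∫ x, ‖curl (u s) x‖ ^ 2) := mul_le_mul_of_nonneg_left hZclose hl.le
    have h2 : ε ^ 2 ≤ ε₀ ^ 2 := pow_le_pow_left₀ hε.le hεε₀ 2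
    have h3 := mul_le_mul_of_nonneg_right h2 hZ0pos.le
    nlinarith only [h1, h3]
  -- the evaluation time: `η W(ũ0) = L / l₀⁻¹²`
  have htime : η * (64 * (1 : ℝ) ^ 3 / (27 * c ^ 4) * (l₀⁻¹ * ∫ x, ‖curl (u s) x‖ ^ 2)⁻¹ ^ 2) = L / l₀⁻¹ ^ 2 := by
    rw [hL_def]
    field_simp
  have hback : s + l₀⁻¹ ^ 2 * (L / l₀⁻¹ ^ 2) = s + L := by
    congr 1
    field_simp
  -- the normalised shadowing applied to the transported flow
  have key := hN _ qt (L / l₀⁻¹ ^ 2) hwcl hwS hwSt hwq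
  simp only [mul_zero, add_zero] at key
  rw [hZ0] at key
  have key' := key hZ0pos hZdiff (le_of_eq htime)
  rw [htime] at key'
  -- back to `u`: `Z(ũ(L/l₀⁻¹²)) = l₀⁻¹ Z(u(s+L))`
  have hZ1 : (∫ x, ‖curl (fun x => l₀⁻¹ • R₀.symm (u (s + l₀⁻¹ ^ 2 * (L / l₀⁻¹ ^ 2))
      (l₀⁻¹ • R₀.symm.symm (x - -(l₀ • R₀.symm a₀))))) x‖ ^ 2) = l₀⁻¹ * ∫ x, ‖curl (u (s + L)) x‖ ^ 2 := by
    rw [hback]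
    exact integral_curl_sq_orbitSlice (u (s + L)) (-(l₀ • R₀.symm a₀)) R₀.symm hl
  rw [hZ1] at key'
  -- multiply by `l₀`
  have hl₀inv : l₀ * l₀⁻¹ = 1 := mul_inv_cancel₀ hl₀.ne'
  have h := mul_le_mul_of_nonneg_left key' hl₀.le
  have e1 : l₀ * (l₀⁻¹ * ∫ x, ‖curl (u (s + L)) x‖ ^ 2) = ∫ x, ‖curl (u (s + L)) x‖ ^ 2 := by
    rw [← mul_assoc, hl₀inv, one_mul]
  have e2 : l₀ * ((∫ x, ‖curl (v (η * (64 * (1 : ℝ) ^ 3 / (27 * c ^ 4) * (∫ x, ‖curl m x‖ ^ 2)⁻¹ ^ 2))) x‖ ^ 2) +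
      κ * (l₀⁻¹ * ∫ x, ‖curl (u s) x‖ ^ 2)) =
      l₀ * (∫ x, ‖curl (v (η * (64 * (1 : ℝ) ^ 3 / (27 * c ^ 4) * (∫ x, ‖curl m x‖ ^ 2)⁻¹ ^ 2))) x‖ ^ 2) +
        κ * ∫ x, ‖curl (u s) x‖ ^ 2 := by
    have : l₀ * (κ * (l₀⁻¹ * ∫ x, ‖curl (u s) x‖ ^ 2)) = κ * ∫ x, ‖curl (u s) x‖ ^ 2 := by
      rw [mul_left_comm, ← mul_assoc l₀, hl₀inv, one_mul]
    rw [mul_add, this]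
  rw [e1, e2] at h
  exact h

/-! ## §4 `RigidExit` -/

/-- **`RigidExit` (stmt-NavierStokesRegularity-25513): `MaximiserSetRigidity → NearMaximiserBoundedAmplification`.** Under clause
(a)+(b) of `MaximiserSetRigidity`, for the sharp Lu–Doering constant and each normalised maximiser `m` at `ν = 1`: the reference
flow `v` through `m` (Leray's local regular `H¹` flow) has a strict early cubic-law deficit (instant exit: no interval of normalised
maximisers along a classical solution, by the tangent-cone/orbit-rate analysis and the Liouville clause (b)); every route-class flow
passing `ε`-close to the orbit of `m` shadows `v` in `Ḣ¹` on the early window (robustness of regularity with the slicewise-Agmon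
rate, symmetry transport, enstrophy covariance), hence inherits a uniform early deficit; the landed real-variable mechanism
(`rigidExit_of_orbitwiseEarlyDeficit`) turns orbitwise uniform early deficits into ONE pair `(A, ε)` (finitely many orbits;
`ν`-uniformity by scaling). [cite: RobinsonRodrigoSadowskiCUP2016, Thm 9.1] -/
theorem efficiencyFloor_rigidExit_proof :
    Summit.NavierStokesRegularity.NavierStokesRegularity.Theses.EfficiencyFloor.RigidExit := by
  refine rigidExit_of_referenceShadowing_of_maximiserSetRigidity fun hMSR c hsharp m hm => ?_
  have hc : 0 < c := hsharp.1
  have hcadm := hsharp.2.1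
  have hmadm := hm.1
  have hZm : 0 < ∫ x, ‖curl m x‖ ^ 2 := hm.2.1
  -- the reference flow on the window fraction `[0, η₀ W_m]`
  obtain ⟨η₀, hη₀, hη₀1, href⟩ := ReferenceFlow.exists_referenceFlow_window c hc
  obtain ⟨v, q, hLH, hv0, hH1, hcl, hpk⟩ := href 1 one_pos m hmadm hZm
  have hW : 0 < 64 * (1 : ℝ) ^ 3 / (27 * c ^ 4) * (∫ x, ‖curl m x‖ ^ 2)⁻¹ ^ 2 := by positivity
  have hT : 0 < η₀ * (64 * (1 : ℝ) ^ 3 / (27 * c ^ 4) * (∫ x, ‖curl m x‖ ^ 2)⁻¹ ^ 2) := by positivity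
  have hB : ∀ δ : ℝ, 0 < δ → δ ≤ η₀ * (64 * (1 : ℝ) ^ 3 / (27 * c ^ 4) * (∫ x, ‖curl m x‖ ^ 2)⁻¹ ^ 2) →
      HasBoundedSobolevNormsOn (Icc δ (η₀ * (64 * (1 : ℝ) ^ 3 / (27 * c ^ 4) * (∫ x, ‖curl m x‖ ^ 2)⁻¹ ^ 2))) v :=
    fun δ hδ hδT => (hpk δ hδ hδT).1
  have hBt := fun δ hδ hδT => (hpk δ hδ hδT).2.1
  have hq := fun δ hδ hδT => (hpk δ hδ hδT).2.2.2
  -- `η = η₀/8`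
  have hη0 : 0 < η₀ / 8 := by positivity
  have hη1 : η₀ / 8 < 1 := by linarith
  have hη4 : η₀ / 8 ≤ 1 / 4 := by linarith
  have hηT : η₀ / 8 * (64 * (1 : ℝ) ^ 3 / (27 * c ^ 4) * (∫ x, ‖curl m x‖ ^ 2)⁻¹ ^ 2) <
      η₀ * (64 * (1 : ℝ) ^ 3 / (27 * c ^ 4) * (∫ x, ‖curl m x‖ ^ 2)⁻¹ ^ 2) := by nlinarith
  have hηT2 : 2 * (η₀ / 8 * (64 * (1 : ℝ) ^ 3 / (27 * c ^ 4) * (∫ x, ‖curl m x‖ ^ 2)⁻¹ ^ 2)) <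
      η₀ * (64 * (1 : ℝ) ^ 3 / (27 * c ^ 4) * (∫ x, ‖curl m x‖ ^ 2)⁻¹ ^ 2) := by nlinarith
  -- (R-exit): the reference deficit, from `MaximiserSetRigidity`
  obtain ⟨θ, hθ, h1⟩ := ReferenceExit.referenceDeficit_of_maximiserSetRigidity hMSR hsharp one_pos hT hm hLH hv0 hH1 hcl hB
    hη0 hηT
  -- `κ` and `ε`
  obtain ⟨κ, hκ, hκ1, hside⟩ := exists_compat hη0 hη1 hθ
  obtain ⟨ε₀, hε₀, hN⟩ := normalised_shadowing one_pos hT hLH hv0 hH1 hcl hB hBt hq hmadm hc hcadm hZm hη0 hη4 hηT2 hκ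
  obtain ⟨ε, hε_def⟩ : ∃ e : ℝ, e = min ε₀ (κ / 3) := ⟨_, rfl⟩
  have hε : 0 < ε := by rw [hε_def]; exact lt_min hε₀ (by positivity)
  have hεε₀ : ε ≤ ε₀ := by rw [hε_def]; exact min_le_left _ _
  have hεκ : ε ≤ κ / 3 := by rw [hε_def]; exact min_le_right _ _
  have hε1 : ε ≤ 1 := by linarith
  have hκε : (1 + ε) ^ 2 ≤ 1 + κ := by nlinarith
  refine ⟨η₀ / 8, θ, κ, ε, v, hη0, hη1, hθ, hκ.le, hε, hside, h1, ?_⟩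
  exact shadowing_of_normalised hc hmadm hη0 hε hεε₀ hε1 hκε hN

end ReferenceShadowing

end RigidExit

end Summit.NavierStokesRegularity.NavierStokesRegularity.Theorems

end
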